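import Summits.ResolutionOfSingularities.ResolutionOfSingularities.Theorems.PurelyInseparableDim4ResConeWeightLedgerPermanenceFree
import Summits.ResolutionOfSingularities.ResolutionOfSingularities.Theorems.PurelyInseparableDim4ResConeWeightLedgerSevenSixLossy
import Summits.ResolutionOfSingularities.ResolutionOfSingularities.Theorems.PurelyInseparableDim4ResConeWeightLedgerSevenFiveLossy
import Summits.ResolutionOfSingularities.ResolutionOfSingularities.Theorems.PurelyInseparableDim4ResConeWeightLedgerSevenFourLossy
import Summits.ResolutionOfSingularities.ResolutionOfSingularities.Theorems.PurelyInseparableDim4ResConeWeightLedgerSevenThreeLossy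
import HarnessLib
import HarnessLib.Audit.Tags

/-!
# Purely inseparable four-folds — THE T-SECTOR B-LOSSY ROW LIST AT `p = 7` ‖ K: lossy `(7, d, 3)` tails with a weightless uncharted letter
# (cell `res-dim4-pi`, K2(p) lane, rung 2 rows B1–B4, LOSSY branch in the T-sector; seat res-dim4-p-8 g7)

[OURS · counted 0 · cell `res-dim4-pi` · K2(p) lane (holder res-dim4-p-12 g5, DATUM «T-SECTOR LOSSY POWER-CONE LEDGER RESIDUES at (7, d)», bus
2026-08-29 l.6609, `tsector7.py` 6e3c7103f0ca0758; K-twin res-dim4-p-8 g6 `blf.py`, l.6612) · seat res-dim4-p-8 g7.]  **HONEST LABEL.**  BOOKKEEPING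
about OUR MODEL at the prime `7`: the theorems say in which finite classes of (frozen weights, boundary weights) a hypothetical LOSSY
`(7, d)` tail with a weightless uncharted letter would have to live — the kernel edition of the holder's T-sector B-LOSSY row list.  They kill
nothing by themselves: every listed residue is LIVE in the ledger, and closing it needs geometry (a mechanism for lossy rotations / heavy
zoos).  Nothing here proves TAIL(7, d, 3), K2(7), K2(p), `NoIsolatedTrap 7 7`, CJS 6.40 or resolution of singularities in dimension ≥ 4 /
characteristic `p` — NOT proved.  AI kernel work, weaker than expert review.

THE INPUT «T-SECTOR»: a letter `φ` with `r_k φ = 0` and `j k ≠ φ` for `k ≥ k₀` — what res-dim4-p-1's T-sector normal form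
`powerCone_freeCarrier_representation` (p715478) supplies for the form-carrying letter of a power-cone (`e_G = 3`) tail after re-presentation;
translations of `φ` are allowed (the EFFECTIVE monitor of `…WeightLedgerPermanenceFree` ignores them).
* §1 (pure tables, `decide +kernel`) `frozenWts` / `cls` / `hasFrozenZero` and the four row lists **`tsectorRows7d`** with
  **`tsector_rows_seven_d`** (`d = 6, 5, 4, 3`): every LEGAL state `a` at a frozen set `P` with a weightless frozen letter whose `(7, d)` LOSSY
  residue `verdictPL7d (hPL7d P a)` is LIVE has `(frozen weights, class) ∈ tsectorRows7d` — read off res-dim4-p-8 g6's certificates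
  `certPL76/75/74/73` (p718538 / p718559 / p718563 / p718569).  THE LISTS (frozen weights ↦ classes of the whole state, weights sorted):
  · `(7,6)`: `[0] ↦ (2), (2,1), (2,2), (2,2,1), (3), (3,2), (4), (4,1)` and the light pair `(1,1)`; `[0,0] ↦ (2), (2,1), (2,2), (3), (3,2), (4)`;
  · `(7,5)`: `[0] ↦ (2,2)` and `(2,1), (2,1,1), (2,2,1), (3), (3,1), (3,2), (3,2,1), (4,1)`; `[0,0] ↦ (3), (3,1), (3,2)`;
    `[0,1] ↦ (2,1), (2,1,1), (2,2,1), (3,1), (3,2,1), (4,1)`;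
  · `(7,4)`: `[0] ↦ (2,2), (2,2,1), (2,2,2), (3,2)` and `(3,1), (3,1,1), (3,2,1)`; `[0,2] ↦ (2,2), (2,2,1), (2,2,2), (3,2)`; `[0,1] ↦ (3,1), (3,1,1), (3,2,1)`;
  · `(7,3)`: `[0,3] ↦ (3,2), (3,2,1)` ONLY (the holder's «frozen 3 + active (2)/(2,1)»).
  These are the holder's `tsector7` rows (one weightless letter) together with the finer two-frozen-letter sub-rows — K = B with `tsector7.py` /
  `blf.py`, now ‖ K.
* §2 **`tail_tsector_lossy_seven_d`** (`d = 6, 5, 4, 3`): every witnessed isolated above-floor `Step0 7` chain of constant shade `d`, lossy beyond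
  every index, with a letter weightless and uncharted from `k₀` on, has a frozen set `P ∋ φ` and a time `k₂` from which
  `(frozenWts P r_k, cls r_k) ∈ tsectorRows7d`; frozen letters are never charted nor lost, the others are charted or lost beyond every index
  (`tail_lossy_confined_freeLetter` ∘ `certPL7d` ∘ §1).  ANY `e_G` (the power-cone reading `e_G = 3` is the intended one).
[cite: CossartJannsenSaito2020, Thm. 3.14] bears_on: LADDER-RESOLUTION:D157-DOOR2 (res-dim4-pi · K2(7) rung 2 · T-sector B-LOSSY row list ‖ K).
Supports stmt-ResolutionOfSingularities-16155 (helper).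
-/

set_option linter.dupNamespace false -- mandated namespace of this single-conjunct summit

noncomputable section

namespace Summit.ResolutionOfSingularities.ResolutionOfSingularities.Theorems.PIDim4

namespace ResCone

open MvPolynomial Finset Literature.AlgebraicGeometry.Resolution
open Literature.AlgebraicGeometry.Resolution.CentreBlowup Literature.AlgebraicGeometry.Resolution.Hauser2010

namespace WeightLedger

/-! ## 1. The row lists and their kernel checks -/

/-- The FROZEN WEIGHTS of a state at a frozen set, sorted increasingly. [OURS · bookkeeping] -/
def frozenWts (P : Fin 4 → Bool) (a : Fin 4 → ℕ) : List ℕ :=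
  (((List.finRange 4).filter fun z => P z).map a).insertionSort (· ≤ ·)

/-- The CLASS of a state: its nonzero weights, sorted decreasingly. [OURS · bookkeeping] -/
def cls (a : Fin 4 → ℕ) : List ℕ :=
  (((List.finRange 4).map a).filter fun w => w ≠ 0).insertionSort (· ≥ ·)

/-- Some frozen letter is weightless. [OURS · bookkeeping] -/
def hasFrozenZero (P : Fin 4 → Bool) (a : Fin 4 → ℕ) : Bool :=
  (P 0 && a 0 == 0) || (P 1 && a 1 == 0) || (P 2 && a 2 == 0) || (P 3 && a 3 == 0)

/-- A weightless frozen letter makes `hasFrozenZero` true. [folklore] -/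
theorem hasFrozenZero_of (P : Fin 4 → Bool) (a : Fin 4 → ℕ) {z : Fin 4} (hz : P z = true) (ha : a z = 0) :
    hasFrozenZero P a = true := by
  fin_cases z <;> simp_all [hasFrozenZero]

/-- T-sector LOSSY rows of `(7, 6)` (frozen weights, class). [OURS · ‖ K data] -/
def tsectorRows76 : List (List ℕ × List ℕ) :=
  [([0], [2]), ([0], [2, 1]), ([0], [2, 2]), ([0], [2, 2, 1]), ([0], [3]), ([0], [3, 2]), ([0], [4]), ([0], [4, 1]), ([0], [1, 1]),
   ([0, 0], [2]), ([0, 0], [2, 1]), ([0, 0], [2, 2]), ([0, 0], [3]), ([0, 0], [3, 2]), ([0, 0], [4])]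

/-- T-sector LOSSY rows of `(7, 5)`. [OURS · ‖ K data] -/
def tsectorRows75 : List (List ℕ × List ℕ) :=
  [([0], [2, 2]), ([0], [2, 1]), ([0], [2, 1, 1]), ([0], [2, 2, 1]), ([0], [3]), ([0], [3, 1]), ([0], [3, 2]), ([0], [3, 2, 1]), ([0], [4, 1]),
   ([0, 0], [3]), ([0, 0], [3, 1]), ([0, 0], [3, 2]),
   ([0, 1], [2, 1]), ([0, 1], [2, 1, 1]), ([0, 1], [2, 2, 1]), ([0, 1], [3, 1]), ([0, 1], [3, 2, 1]), ([0, 1], [4, 1])]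

/-- T-sector LOSSY rows of `(7, 4)`. [OURS · ‖ K data] -/
def tsectorRows74 : List (List ℕ × List ℕ) :=
  [([0], [2, 2]), ([0], [2, 2, 1]), ([0], [2, 2, 2]), ([0], [3, 2]), ([0], [3, 1]), ([0], [3, 1, 1]), ([0], [3, 2, 1]),
   ([0, 2], [2, 2]), ([0, 2], [2, 2, 1]), ([0, 2], [2, 2, 2]), ([0, 2], [3, 2]),
   ([0, 1], [3, 1]), ([0, 1], [3, 1, 1]), ([0, 1], [3, 2, 1])]

/-- T-sector LOSSY rows of `(7, 3)`: one type only. [OURS · ‖ K data] -/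
def tsectorRows73 : List (List ℕ × List ℕ) := [([0, 3], [3, 2]), ([0, 3], [3, 2, 1])]

set_option maxHeartbeats 4000000 in
/-- Kernel check of the `(7, 6)` rows over all frozen-flag vectors and all weight vectors below `6`. [OURS · ‖ K] -/
theorem tsector_rows_seven_6_dec : ∀ s0 s1 s2 s3 : Bool, ∀ a0 a1 a2 a3 : Fin 6,
    legalB 7 6 ![(a0 : ℕ), a1, a2, a3] = true → hasFrozenZero ![s0, s1, s2, s3] ![(a0 : ℕ), a1, a2, a3] = true →
    verdictPL76 (hPL76 ![s0, s1, s2, s3] ![(a0 : ℕ), a1, a2, a3]) = 0 →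
    (frozenWts ![s0, s1, s2, s3] ![(a0 : ℕ), a1, a2, a3], cls ![(a0 : ℕ), a1, a2, a3]) ∈ tsectorRows76 := by
  decide +kernel

set_option maxHeartbeats 4000000 in
/-- Kernel check of the `(7, 5)` rows. [OURS · ‖ K] -/
theorem tsector_rows_seven_5_dec : ∀ s0 s1 s2 s3 : Bool, ∀ a0 a1 a2 a3 : Fin 6,
    legalB 7 5 ![(a0 : ℕ), a1, a2, a3] = true → hasFrozenZero ![s0, s1, s2, s3] ![(a0 : ℕ), a1, a2, a3] = true →
    verdictPL75 (hPL75 ![s0, s1, s2, s3] ![(a0 : ℕ), a1, a2, a3]) = 0 →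
    (frozenWts ![s0, s1, s2, s3] ![(a0 : ℕ), a1, a2, a3], cls ![(a0 : ℕ), a1, a2, a3]) ∈ tsectorRows75 := by
  decide +kernel

set_option maxHeartbeats 4000000 in
/-- Kernel check of the `(7, 4)` rows. [OURS · ‖ K] -/
theorem tsector_rows_seven_4_dec : ∀ s0 s1 s2 s3 : Bool, ∀ a0 a1 a2 a3 : Fin 6,
    legalB 7 4 ![(a0 : ℕ), a1, a2, a3] = true → hasFrozenZero ![s0, s1, s2, s3] ![(a0 : ℕ), a1, a2, a3] = true →
    verdictPL74 (hPL74 ![s0, s1, s2, s3] ![(a0 : ℕ), a1, a2, a3]) = 0 →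
    (frozenWts ![s0, s1, s2, s3] ![(a0 : ℕ), a1, a2, a3], cls ![(a0 : ℕ), a1, a2, a3]) ∈ tsectorRows74 := by
  decide +kernel

set_option maxHeartbeats 4000000 in
/-- Kernel check of the `(7, 3)` rows. [OURS · ‖ K] -/
theorem tsector_rows_seven_3_dec : ∀ s0 s1 s2 s3 : Bool, ∀ a0 a1 a2 a3 : Fin 6,
    legalB 7 3 ![(a0 : ℕ), a1, a2, a3] = true → hasFrozenZero ![s0, s1, s2, s3] ![(a0 : ℕ), a1, a2, a3] = true →
    verdictPL73 (hPL73 ![s0, s1, s2, s3] ![(a0 : ℕ), a1, a2, a3]) = 0 →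
    (frozenWts ![s0, s1, s2, s3] ![(a0 : ℕ), a1, a2, a3], cls ![(a0 : ℕ), a1, a2, a3]) ∈ tsectorRows73 := by
  decide +kernel

/-- Binder reduction: a property of all (frozen set, legal state) pairs follows from its instances at `![s0, s1, s2, s3]`, `![a0, a1, a2, a3]`
with `aᵢ : Fin 6` (legal weights at `p = 7` are `≤ 5`). [folklore] -/
theorem forall_flags_legal_seven {d : ℕ} {Q : (Fin 4 → Bool) → (Fin 4 → ℕ) → Prop}
    (H : ∀ s0 s1 s2 s3 : Bool, ∀ a0 a1 a2 a3 : Fin 6, legalB 7 d ![(a0 : ℕ), a1, a2, a3] = true → Q ![s0, s1, s2, s3] ![(a0 : ℕ), a1, a2, a3]) :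
    ∀ P a, Legal 7 d a → Q P a := by
  intro P
  refine forall_legal_of_forall_fin4 (p := 7) (d := d) (P := fun a => Legal 7 d a → Q P a) ?_ |> fun h a ha => h a ha ha
  intro a0 a1 a2 a3 hleg
  have hP : (![P 0, P 1, P 2, P 3] : Fin 4 → Bool) = P := by ext i; fin_cases i <;> rfl
  rw [← hP]
  exact H _ _ _ _ a0 a1 a2 a3 ((legalB_eq_true_iff _).mpr hleg)

/-- **THE T-SECTOR LOSSY ROWS OF `(7, 6)`**: a legal state at a frozen set with a weightless frozen letter whose `(7, 6)` lossy residue is LIVE lies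
in `tsectorRows76`. [OURS · ‖ K] -/
theorem tsector_rows_seven_6 : ∀ (P : Fin 4 → Bool) (a : Fin 4 → ℕ), Legal 7 6 a → hasFrozenZero P a = true →
    verdictPL76 (hPL76 P a) = 0 → (frozenWts P a, cls a) ∈ tsectorRows76 :=
  forall_flags_legal_seven fun s0 s1 s2 s3 a0 a1 a2 a3 hl => tsector_rows_seven_6_dec s0 s1 s2 s3 a0 a1 a2 a3 hl

/-- **THE T-SECTOR LOSSY ROWS OF `(7, 5)`.** [OURS · ‖ K] -/
theorem tsector_rows_seven_5 : ∀ (P : Fin 4 → Bool) (a : Fin 4 → ℕ), Legal 7 5 a → hasFrozenZero P a = true →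
    verdictPL75 (hPL75 P a) = 0 → (frozenWts P a, cls a) ∈ tsectorRows75 :=
  forall_flags_legal_seven fun s0 s1 s2 s3 a0 a1 a2 a3 hl => tsector_rows_seven_5_dec s0 s1 s2 s3 a0 a1 a2 a3 hl

/-- **THE T-SECTOR LOSSY ROWS OF `(7, 4)`.** [OURS · ‖ K] -/
theorem tsector_rows_seven_4 : ∀ (P : Fin 4 → Bool) (a : Fin 4 → ℕ), Legal 7 4 a → hasFrozenZero P a = true →
    verdictPL74 (hPL74 P a) = 0 → (frozenWts P a, cls a) ∈ tsectorRows74 :=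
  forall_flags_legal_seven fun s0 s1 s2 s3 a0 a1 a2 a3 hl => tsector_rows_seven_4_dec s0 s1 s2 s3 a0 a1 a2 a3 hl

/-- **THE T-SECTOR LOSSY ROWS OF `(7, 3)`**: one type only — a frozen weight-`3` letter, the weightless frozen letter, and active weights `(2)` or
`(2, 1)`. [OURS · ‖ K] -/
theorem tsector_rows_seven_3 : ∀ (P : Fin 4 → Bool) (a : Fin 4 → ℕ), Legal 7 3 a → hasFrozenZero P a = true →
    verdictPL73 (hPL73 P a) = 0 → (frozenWts P a, cls a) ∈ tsectorRows73 :=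
  forall_flags_legal_seven fun s0 s1 s2 s3 a0 a1 a2 a3 hl => tsector_rows_seven_3_dec s0 s1 s2 s3 a0 a1 a2 a3 hl

end WeightLedger

open WeightLedger

/-! ## 2. The chains: T-sector lossy tails at `p = 7` -/

section Chain

variable {K : Type} [Field K] [CharP K 7] [DecidableEq K] {c : ℕ → State K} {j : ℕ → Fin 4} {b : ℕ → Fin 4 → K}

/-- **T-SECTOR LOSSY `(7, 6)` TAILS LIVE IN `tsectorRows76`** (any `e_G`): a witnessed isolated above-floor `Step0 7` chain of constant shade `6`,
lossy beyond every index, with a letter `φ` weightless and uncharted from `k₀` on, has a frozen set `P ∋ φ` (never charted nor lost; the other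
letters charted or lost beyond every index) and a time from which `(frozenWts P r_k, cls r_k) ∈ tsectorRows76`. [OURS · ‖ K]
[cite: CossartJannsenSaito2020, Thm. 3.14] -/
theorem tail_tsector_lossy_seven_6
    (hc : ∀ k, IsIsolated 7 (c k).F ∧ Step0 7 (c k) (c (k + 1))) (hw : FreeTail.IsWitnessedChain 7 c j b)
    (hr0 : ∀ e ∈ (c 0).F.support, (c 0).r ≤ e) (hfloor : ∀ k, ordZero (c k).F ≠ 7) {k₀ : ℕ}
    (hshade : ∀ k, k₀ ≤ k → (c k).shade = ((6 : ℕ) : ℕ∞)) (hlossy : ∀ k₂, ∃ k, k₂ ≤ k ∧ Lossy ⇑(c k).r ⇑(c (k + 1)).r)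
    {φ : Fin 4} (hφ : ∀ k, k₀ ≤ k → (c k).r φ = 0 ∧ j k ≠ φ) :
    ∃ (P : Fin 4 → Bool) (k₂ : ℕ), k₀ ≤ k₂ ∧ P φ = true ∧
      (∀ k, k₂ ≤ k → (frozenWts P ⇑(c k).r, cls ⇑(c k).r) ∈ tsectorRows76) ∧
      (∀ k, k₂ ≤ k → ∀ z, P z = true → j k ≠ z ∧ (b k z = 0 ∨ (c k).r z = 0)) ∧
      (∀ z, P z = false → ∀ k₃, ∃ k, k₃ ≤ k ∧ (j k = z ∨ (b k z ≠ 0 ∧ (c k).r z ≠ 0))) := by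
  haveI : Fact (Nat.Prime 7) := ⟨by norm_num⟩
  obtain ⟨P, i, k₂, hv, hk₂, hPφ, hlev, hfrozen, hhit⟩ :=
    tail_lossy_confined_freeLetter 7 hc hw hr0 hfloor hshade hlossy hφ certPL76
  refine ⟨P, k₂, hk₂, hPφ, fun k hk => ?_, hfrozen, hhit⟩
  obtain ⟨hleg, hh, hr⟩ := hlev k hk
  exact tsector_rows_seven_6 P _ hleg (hasFrozenZero_of P _ hPφ hr) (by rw [hh]; exact hv)

/-- **T-SECTOR LOSSY `(7, 5)` TAILS LIVE IN `tsectorRows75`** (any `e_G`). [OURS · ‖ K] [cite: CossartJannsenSaito2020, Thm. 3.14] -/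
theorem tail_tsector_lossy_seven_5
    (hc : ∀ k, IsIsolated 7 (c k).F ∧ Step0 7 (c k) (c (k + 1))) (hw : FreeTail.IsWitnessedChain 7 c j b)
    (hr0 : ∀ e ∈ (c 0).F.support, (c 0).r ≤ e) (hfloor : ∀ k, ordZero (c k).F ≠ 7) {k₀ : ℕ}
    (hshade : ∀ k, k₀ ≤ k → (c k).shade = ((5 : ℕ) : ℕ∞)) (hlossy : ∀ k₂, ∃ k, k₂ ≤ k ∧ Lossy ⇑(c k).r ⇑(c (k + 1)).r)
    {φ : Fin 4} (hφ : ∀ k, k₀ ≤ k → (c k).r φ = 0 ∧ j k ≠ φ) :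
    ∃ (P : Fin 4 → Bool) (k₂ : ℕ), k₀ ≤ k₂ ∧ P φ = true ∧
      (∀ k, k₂ ≤ k → (frozenWts P ⇑(c k).r, cls ⇑(c k).r) ∈ tsectorRows75) ∧
      (∀ k, k₂ ≤ k → ∀ z, P z = true → j k ≠ z ∧ (b k z = 0 ∨ (c k).r z = 0)) ∧
      (∀ z, P z = false → ∀ k₃, ∃ k, k₃ ≤ k ∧ (j k = z ∨ (b k z ≠ 0 ∧ (c k).r z ≠ 0))) := by
  haveI : Fact (Nat.Prime 7) := ⟨by norm_num⟩
  obtain ⟨P, i, k₂, hv, hk₂, hPφ, hlev, hfrozen, hhit⟩ :=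
    tail_lossy_confined_freeLetter 7 hc hw hr0 hfloor hshade hlossy hφ certPL75
  refine ⟨P, k₂, hk₂, hPφ, fun k hk => ?_, hfrozen, hhit⟩
  obtain ⟨hleg, hh, hr⟩ := hlev k hk
  exact tsector_rows_seven_5 P _ hleg (hasFrozenZero_of P _ hPφ hr) (by rw [hh]; exact hv)

/-- **T-SECTOR LOSSY `(7, 4)` TAILS LIVE IN `tsectorRows74`** (any `e_G`). [OURS · ‖ K] [cite: CossartJannsenSaito2020, Thm. 3.14] -/
theorem tail_tsector_lossy_seven_4
    (hc : ∀ k, IsIsolated 7 (c k).F ∧ Step0 7 (c k) (c (k + 1))) (hw : FreeTail.IsWitnessedChain 7 c j b)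
    (hr0 : ∀ e ∈ (c 0).F.support, (c 0).r ≤ e) (hfloor : ∀ k, ordZero (c k).F ≠ 7) {k₀ : ℕ}
    (hshade : ∀ k, k₀ ≤ k → (c k).shade = ((4 : ℕ) : ℕ∞)) (hlossy : ∀ k₂, ∃ k, k₂ ≤ k ∧ Lossy ⇑(c k).r ⇑(c (k + 1)).r)
    {φ : Fin 4} (hφ : ∀ k, k₀ ≤ k → (c k).r φ = 0 ∧ j k ≠ φ) :
    ∃ (P : Fin 4 → Bool) (k₂ : ℕ), k₀ ≤ k₂ ∧ P φ = true ∧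
      (∀ k, k₂ ≤ k → (frozenWts P ⇑(c k).r, cls ⇑(c k).r) ∈ tsectorRows74) ∧
      (∀ k, k₂ ≤ k → ∀ z, P z = true → j k ≠ z ∧ (b k z = 0 ∨ (c k).r z = 0)) ∧
      (∀ z, P z = false → ∀ k₃, ∃ k, k₃ ≤ k ∧ (j k = z ∨ (b k z ≠ 0 ∧ (c k).r z ≠ 0))) := by
  haveI : Fact (Nat.Prime 7) := ⟨by norm_num⟩
  obtain ⟨P, i, k₂, hv, hk₂, hPφ, hlev, hfrozen, hhit⟩ :=
    tail_lossy_confined_freeLetter 7 hc hw hr0 hfloor hshade hlossy hφ certPL74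
  refine ⟨P, k₂, hk₂, hPφ, fun k hk => ?_, hfrozen, hhit⟩
  obtain ⟨hleg, hh, hr⟩ := hlev k hk
  exact tsector_rows_seven_4 P _ hleg (hasFrozenZero_of P _ hPφ hr) (by rw [hh]; exact hv)

/-- **T-SECTOR LOSSY `(7, 3)` TAILS LIVE IN `tsectorRows73`** (any `e_G`): the frozen set is `{φ, z₃}` with `r z₃ = 3`, and the two active
letters carry `(2)` or `(2, 1)` — the holder's «frozen 3 + active (2)/(2,1)». [OURS · ‖ K] [cite: CossartJannsenSaito2020, Thm. 3.14] -/
theorem tail_tsector_lossy_seven_3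
    (hc : ∀ k, IsIsolated 7 (c k).F ∧ Step0 7 (c k) (c (k + 1))) (hw : FreeTail.IsWitnessedChain 7 c j b)
    (hr0 : ∀ e ∈ (c 0).F.support, (c 0).r ≤ e) (hfloor : ∀ k, ordZero (c k).F ≠ 7) {k₀ : ℕ}
    (hshade : ∀ k, k₀ ≤ k → (c k).shade = ((3 : ℕ) : ℕ∞)) (hlossy : ∀ k₂, ∃ k, k₂ ≤ k ∧ Lossy ⇑(c k).r ⇑(c (k + 1)).r)
    {φ : Fin 4} (hφ : ∀ k, k₀ ≤ k → (c k).r φ = 0 ∧ j k ≠ φ) :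
    ∃ (P : Fin 4 → Bool) (k₂ : ℕ), k₀ ≤ k₂ ∧ P φ = true ∧
      (∀ k, k₂ ≤ k → (frozenWts P ⇑(c k).r, cls ⇑(c k).r) ∈ tsectorRows73) ∧
      (∀ k, k₂ ≤ k → ∀ z, P z = true → j k ≠ z ∧ (b k z = 0 ∨ (c k).r z = 0)) ∧
      (∀ z, P z = false → ∀ k₃, ∃ k, k₃ ≤ k ∧ (j k = z ∨ (b k z ≠ 0 ∧ (c k).r z ≠ 0))) := by
  haveI : Fact (Nat.Prime 7) := ⟨by norm_num⟩
  obtain ⟨P, i, k₂, hv, hk₂, hPφ, hlev, hfrozen, hhit⟩ :=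
    tail_lossy_confined_freeLetter 7 hc hw hr0 hfloor hshade hlossy hφ certPL73
  refine ⟨P, k₂, hk₂, hPφ, fun k hk => ?_, hfrozen, hhit⟩
  obtain ⟨hleg, hh, hr⟩ := hlev k hk
  exact tsector_rows_seven_3 P _ hleg (hasFrozenZero_of P _ hPφ hr) (by rw [hh]; exact hv)

end Chain

end ResCone

end Summit.ResolutionOfSingularities.ResolutionOfSingularities.Theorems.PIDim4

end
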